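import Mathlib
import HarnessLib

/-!
# Crux `CardyShadowIsolated` (stmt-CriticalPhenomena-5767), line `dilation-dynamics`:
# Butler–Waltman lemma for product-space ω-limit sets — unstable half (registered stub `stub_butlerWaltmanUnstable`)

Setting: an index type `ι`, an action `T : ℝ → ι → ι` of the additive reals on indices
(`T u (T t i) = T (u + t) i`) acting on functions `h : ι → ℝ` by `h ↦ fun i => h (T t i)`; an
orbit `x : ℝ → ι → ℝ` of this action (`x (s + t) i = x s (T t i)`) with values in a compact set
`K`, asymptotically continuous in each coordinate; `Λ = {h | MapClusterPt h atTop x}` its ω-limit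
set in the product topology. If a fixed point `g ∈ Λ` is an isolated invariant set of `Λ` and no
other point of `Λ` tends to `g` in backward time, then `Λ = {g}`: otherwise the orbit enters a
box around `g` for longer and longer sojourns and leaves it again; the last in-box points before
the exits accumulate at a point `z ∈ Λ`, `z ≠ g`, whose whole backward orbit stays in the box, so
its α-limit set is an invariant subset of the box, i.e. `{g}`, and `z → g` in backward time —
contradicting the triviality of the unstable set.
-/

namespace Summit.CriticalPhenomena.CardyFormulaZ2.Theorems.CardyShadowIsolated.DilationDynamics

open Set Filter Topology

section ButlerWaltman

variable {ι : Type*} (T : ℝ → ι → ι) (x : ℝ → ι → ℝ)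

/-- The ω-limit set `{h | MapClusterPt h atTop x}` of an orbit `x (s + t) = (x s) ∘ T t` is
invariant under every `h ↦ h ∘ T t`. [folklore] -/
theorem mapClusterPt_comp_of_orbit (hgrp : ∀ s t i, x (s + t) i = x s (T t i)) {h : ι → ℝ}
    (hh : MapClusterPt h atTop x) (t : ℝ) : MapClusterPt (fun i => h (T t i)) atTop x := by
  have hc : Continuous fun (k : ι → ℝ) (i : ι) => k (T t i) :=
    continuous_pi fun i => continuous_apply (T t i)
  have h1 : MapClusterPt (fun i => h (T t i)) atTop
      ((fun (k : ι → ℝ) (i : ι) => k (T t i)) ∘ x) :=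
    hh.continuousAt_comp hc.continuousAt
  have h2 : ((fun (k : ι → ℝ) (i : ι) => k (T t i)) ∘ x) = x ∘ fun s => s + t := by
    funext s i
    simp only [Function.comp_apply]
    exact (hgrp s t i).symm
  rw [h2] at h1
  exact MapClusterPt.of_comp (tendsto_atTop_add_const_right _ _ tendsto_id) h1

/-- Asymptotic continuity of the orbit, uniformly over a finite set of coordinates. [folklore] -/
theorem tail_continuity_finset
    (hcont : ∀ i, ∀ ε > (0 : ℝ), ∃ κ > (0 : ℝ), ∃ S : ℝ, ∀ s, S ≤ s →
      ∀ u ∈ Icc (0 : ℝ) κ, |x (s + u) i - x s i| < ε)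
    (I : Finset ι) (ε : ι → ℝ) (hε : ∀ i, 0 < ε i) :
    ∃ κ > (0 : ℝ), ∃ S : ℝ, ∀ i ∈ I, ∀ s, S ≤ s →
      ∀ u ∈ Icc (0 : ℝ) κ, |x (s + u) i - x s i| < ε i := by
  classical
  induction I using Finset.induction_on with
  | empty => exact ⟨1, one_pos, 0, fun i hi => absurd hi (Finset.notMem_empty i)⟩
  | insert a I _ IH =>
    obtain ⟨κ, hκ, S, H⟩ := IH
    obtain ⟨κa, hκa, Sa, Ha⟩ := hcont a (ε a) (hε a)
    refine ⟨min κ κa, lt_min hκ hκa, max S Sa, fun i hi s hs u hu => ?_⟩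
    rcases Finset.mem_insert.1 hi with rfl | hi'
    · exact Ha s (le_trans (le_max_right _ _) hs) u ⟨hu.1, hu.2.trans (min_le_right _ _)⟩
    · exact H i hi' s (le_trans (le_max_left _ _) hs) u ⟨hu.1, hu.2.trans (min_le_left _ _)⟩

/-- **Long sojourns near a fixed point of the ω-limit set.** If the fixed point `g`
(`g ∘ T t = g`) is a cluster point of the orbit, then the orbit stays in the half-box
`|x t i - g i| < ε i / 2` (`i ∈ I`) during arbitrarily long, arbitrarily late time intervals.
[folklore] -/
theorem exists_long_sojourn
    (hgrp : ∀ s t i, x (s + t) i = x s (T t i))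
    {g : ι → ℝ} (hfix : ∀ t i, g (T t i) = g i) (hg : MapClusterPt g atTop x)
    (I : Finset ι) (ε : ι → ℝ) (hε : ∀ i, 0 < ε i)
    {κ : ℝ} (hκ : 0 < κ) {S : ℝ}
    (hS : ∀ i ∈ I, ∀ s, S ≤ s → ∀ u ∈ Icc (0 : ℝ) κ, |x (s + u) i - x s i| < ε i / 4)
    (m : ℕ) (S₀ : ℝ) :
    ∃ s, S₀ ≤ s ∧ S ≤ s ∧ ∀ t ∈ Icc s (s + m * κ), ∀ i ∈ I, |x t i - g i| < ε i / 2 := by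
  set U : Set (ι → ℝ) :=
    {h | ∀ i ∈ I, ∀ j ∈ Finset.range (m + 1), |h (T (j * κ) i) - g i| < ε i / 4} with hU
  have hUnhds : U ∈ 𝓝 g := by
    have hUeq : U = ⋂ i ∈ I, ⋂ j ∈ Finset.range (m + 1),
        (fun h : ι → ℝ => h (T (j * κ) i)) ⁻¹' Metric.ball (g i) (ε i / 4) := by
      ext h
      simp only [hU, mem_setOf_eq, mem_iInter, mem_preimage, Metric.mem_ball, Real.dist_eq]
    rw [hUeq]
    refine (Filter.biInter_finset_mem I).2 fun i _ => (Filter.biInter_finset_mem _).2 fun j _ => ?_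
    refine (continuous_apply (T (j * κ) i)).continuousAt.preimage_mem_nhds ?_
    show Metric.ball (g i) (ε i / 4) ∈ 𝓝 (g (T (j * κ) i))
    rw [hfix]
    exact Metric.ball_mem_nhds _ (by linarith [hε i])
  have hfreq : ∃ᶠ s in atTop, x s ∈ U := (mapClusterPt_iff_frequently.1 hg) U hUnhds
  have hev : ∀ᶠ s in atTop, S₀ ≤ s ∧ S ≤ s :=
    (eventually_ge_atTop S₀).and (eventually_ge_atTop S)
  obtain ⟨s, hsU, hs₀, hsS⟩ := (hfreq.and_eventually hev).exists
  refine ⟨s, hs₀, hsS, fun t ht i hi => ?_⟩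
  have hts : 0 ≤ t - s := by linarith [ht.1]
  set a : ℝ := (t - s) / κ with ha
  have ha0 : 0 ≤ a := div_nonneg hts hκ.le
  set j : ℕ := ⌊a⌋₊ with hj
  have hja : (j : ℝ) ≤ a := Nat.floor_le ha0
  have haj : a < j + 1 := Nat.lt_floor_add_one a
  have hjm : j ≤ m := by
    have h1 : a ≤ m := by
      rw [ha, div_le_iff₀ hκ]
      linarith [ht.2]
    have h2 : (j : ℝ) ≤ m := hja.trans h1
    exact_mod_cast h2
  have haκ : a * κ = t - s := by rw [ha, div_mul_cancel₀ _ hκ.ne']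
  set u : ℝ := t - s - j * κ with hu
  have hu0 : 0 ≤ u := by
    have : (j : ℝ) * κ ≤ a * κ := mul_le_mul_of_nonneg_right hja hκ.le
    rw [haκ] at this
    linarith
  have huκ : u ≤ κ := by
    have : a * κ < ((j : ℝ) + 1) * κ := mul_lt_mul_of_pos_right haj hκ
    rw [haκ] at this
    linarith
  have ht_eq : t = s + j * κ + u := by rw [hu]; ring
  have hsjS : S ≤ s + j * κ := le_add_of_le_of_nonneg hsS (by positivity)
  have h1 := hS i hi (s + j * κ) hsjS u ⟨hu0, huκ⟩
  have h2 : |x (s + j * κ) i - g i| < ε i / 4 := by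
    rw [hgrp s (j * κ) i]
    exact hsU i hi j (Finset.mem_range.2 (Nat.lt_succ_of_le hjm))
  rw [ht_eq]
  calc |x (s + ↑j * κ + u) i - g i|
      ≤ |x (s + ↑j * κ + u) i - x (s + ↑j * κ) i| + |x (s + ↑j * κ) i - g i| := abs_sub_le _ _ _
    _ < ε i / 4 + ε i / 4 := add_lt_add h1 h2
    _ = ε i / 2 := by ring

/-- **Exit lemma.** A sojourn in the closed box during `[s, s + L]` (`L ≥ κ`) followed by a later
time `v` outside the box produces a time `τ ≥ s + L - κ` at which the orbit is still in the box,
has been in the box since `s`, and is already `ε i / 2`-far from `g` in some coordinate `i ∈ I`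
(by asymptotic continuity, the orbit cannot jump from deep inside the box to outside). [folklore] -/
theorem exists_exit_point
    (I : Finset ι) (ε : ι → ℝ) (g : ι → ℝ)
    {κ : ℝ} (hκ : 0 < κ) {S s L v : ℝ}
    (hS : ∀ i ∈ I, ∀ s', S ≤ s' → ∀ u ∈ Icc (0 : ℝ) κ, |x (s' + u) i - x s' i| < ε i / 4)
    (hSs : S ≤ s) (hL : κ ≤ L)
    (hsoj : ∀ t ∈ Icc s (s + L), ∀ i ∈ I, |x t i - g i| ≤ ε i)
    (hsv : s + L ≤ v) (hv : ∃ i ∈ I, ε i < |x v i - g i|) :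
    ∃ τ, s + L - κ ≤ τ ∧ (∀ t ∈ Icc s τ, ∀ i ∈ I, |x t i - g i| ≤ ε i) ∧
      ∃ i ∈ I, ε i / 2 ≤ |x τ i - g i| := by
  set A : Set ℝ := {σ | s ≤ σ ∧ σ ≤ v ∧ ∀ t ∈ Icc s σ, ∀ i ∈ I, |x t i - g i| ≤ ε i} with hA
  have hmem : s + L ∈ A := ⟨by linarith, hsv, hsoj⟩
  have hne : A.Nonempty := ⟨_, hmem⟩
  have hbdd : BddAbove A := ⟨v, fun σ hσ => hσ.2.1⟩
  set σ := sSup A with hσ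
  have h1 : s + L ≤ σ := le_csSup hbdd hmem
  have h2 : σ ≤ v := csSup_le hne fun σ' h => h.2.1
  have hin : ∀ t, s ≤ t → t < σ → ∀ i ∈ I, |x t i - g i| ≤ ε i := by
    intro t hst htσ
    obtain ⟨σ', hσ'A, htσ'⟩ := exists_lt_of_lt_csSup hne htσ
    exact hσ'A.2.2 t ⟨hst, htσ'.le⟩
  have hout : ∃ t, σ ≤ t ∧ t ≤ σ + κ / 2 ∧ ∃ i ∈ I, ε i < |x t i - g i| := by
    by_cases hvσ : v ≤ σ + κ / 2
    · exact ⟨v, h2, hvσ, hv⟩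
    · push Not at hvσ
      have hnot : σ + κ / 2 ∉ A := fun h => by
        have := le_csSup hbdd h
        linarith
      have hnot' : ¬ ∀ t ∈ Icc s (σ + κ / 2), ∀ i ∈ I, |x t i - g i| ≤ ε i := fun h =>
        hnot ⟨by linarith, hvσ.le, h⟩
      push Not at hnot'
      obtain ⟨t, ht, i, hi, hlt⟩ := hnot'
      refine ⟨t, ?_, ht.2, i, hi, hlt⟩
      by_contra htσ
      push Not at htσ
      exact absurd (hin t ht.1 htσ i hi) (not_le.2 hlt)
  obtain ⟨tout, h3, h4, i, hi, hfar⟩ := hout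
  refine ⟨σ - κ / 2, by linarith, fun t ht j hj => hin t ht.1 (by linarith [ht.2]) j hj, i, hi, ?_⟩
  have hc := hS i hi (σ - κ / 2) (by linarith) (tout - (σ - κ / 2)) ⟨by linarith, by linarith⟩
  have heq : σ - κ / 2 + (tout - (σ - κ / 2)) = tout := by ring
  rw [heq] at hc
  have hle := abs_sub_abs_le_abs_sub (x tout i - g i) (x (σ - κ / 2) i - g i)
  have hsimp : x tout i - g i - (x (σ - κ / 2) i - g i) = x tout i - x (σ - κ / 2) i := by ring
  rw [hsimp] at hle
  have h0 := abs_nonneg (x tout i - x (σ - κ / 2) i)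
  linarith

/-- **Butler–Waltman, unstable half, for product-space ω-limit sets.** Let `x` be an orbit of the
coordinate action `T` (`x (s + t) = (x s) ∘ T t`) with values in a compact set `K` and
asymptotically continuous coordinates, `Λ = {h | MapClusterPt h atTop x}` its ω-limit set and
`g ∈ Λ` a fixed point. If `g` is an isolated invariant set of `Λ` (some neighbourhood `N` of `g`
contains no whole orbit of `Λ` other than `g`) and the unstable set of `g` in `Λ` is trivial (no
`h ∈ Λ`, `h ≠ g`, tends to `g` as `t → -∞`), then `Λ = {g}`.
[cite: ButlerWaltman1986, Lemma A1; SmithThieme2011, Lemma 8.17] -/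
theorem eq_of_isolatedInvariant_of_unstableTrivial
    (hgrp : ∀ s t i, x (s + t) i = x s (T t i))
    (hT : ∀ u t i, T u (T t i) = T (u + t) i)
    {K : Set (ι → ℝ)} (hK : IsCompact K) (hxK : ∀ s, x s ∈ K)
    (hcont : ∀ i, ∀ ε > (0 : ℝ), ∃ κ > (0 : ℝ), ∃ S : ℝ, ∀ s, S ≤ s →
      ∀ u ∈ Icc (0 : ℝ) κ, |x (s + u) i - x s i| < ε)
    {g : ι → ℝ} (hfix : ∀ t i, g (T t i) = g i) (hg : MapClusterPt g atTop x)
    (hC : ∃ N ∈ 𝓝 g, ∀ h : ι → ℝ, MapClusterPt h atTop x →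
      (∀ t : ℝ, (fun i => h (T t i)) ∈ N) → h = g)
    (hD : ∀ h : ι → ℝ, MapClusterPt h atTop x →
      Tendsto (fun (t : ℝ) (i : ι) => h (T t i)) atBot (𝓝 g) → h = g) :
    ∀ h : ι → ℝ, MapClusterPt h atTop x → h = g := by
  classical
  intro g' hg'
  by_contra hne
  -- a coordinate where `g' ≠ g`
  have hex : ∃ i₀, g' i₀ ≠ g i₀ := by
    by_contra h
    push Not at h
    exact hne (funext h)
  obtain ⟨i₀, hi₀⟩ := hex
  set d : ℝ := |g' i₀ - g i₀| / 2 with hd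
  have hdpos : 0 < d := by
    have := abs_pos.2 (sub_ne_zero.2 hi₀)
    rw [hd]
    linarith
  -- the isolating neighbourhood, shrunk to a closed box `∀ i ∈ I, |h i - g i| ≤ ε i` inside `N`
  obtain ⟨N, hN, hiso⟩ := hC
  rw [nhds_pi] at hN
  obtain ⟨I₁, tN, htN, hts⟩ := Filter.mem_pi'.1 hN
  choose ε₁ hε₁ hball using fun i => Metric.nhds_basis_closedBall.mem_iff.1 (htN i)
  set I : Finset ι := insert i₀ I₁ with hI
  set ε : ι → ℝ := fun i => min (ε₁ i) d with hεdef
  have hε : ∀ i, 0 < ε i := fun i => lt_min (hε₁ i) hdpos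
  have hεd : ∀ i, ε i ≤ d := fun i => min_le_right _ _
  have hboxN : ∀ h : ι → ℝ, (∀ i ∈ I, |h i - g i| ≤ ε i) → h ∈ N := by
    intro h hh
    apply hts
    refine Set.mem_pi.2 fun i hi => hball i ?_
    rw [Metric.mem_closedBall, Real.dist_eq]
    exact (hh i (Finset.mem_insert_of_mem (Finset.mem_coe.1 hi))).trans (min_le_left _ _)
  -- asymptotic continuity on `I` with tolerance `ε / 4`
  obtain ⟨κ, hκ, S, hS⟩ :=
    tail_continuity_finset x hcont I (fun i => ε i / 4) (fun i => by linarith [hε i])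
  -- cofinal exits: the orbit is frequently `d/2`-close to `g'` at `i₀`, hence outside the box
  have hexit : ∀ S₁ : ℝ, ∃ v, S₁ ≤ v ∧ ε i₀ < |x v i₀ - g i₀| := by
    intro S₁
    have hV : (fun h : ι → ℝ => h i₀) ⁻¹' Metric.ball (g' i₀) (d / 2) ∈ 𝓝 g' :=
      (continuous_apply i₀).continuousAt.preimage_mem_nhds (Metric.ball_mem_nhds _ (by positivity))
    obtain ⟨v, hv, hSv⟩ :=
      (((mapClusterPt_iff_frequently.1 hg') _ hV).and_eventually (eventually_ge_atTop S₁)).exists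
    refine ⟨v, hSv, ?_⟩
    rw [mem_preimage, Metric.mem_ball, Real.dist_eq] at hv
    have h2d : |g' i₀ - g i₀| = 2 * d := by rw [hd]; ring
    have hle := abs_sub_abs_le_abs_sub (g' i₀ - g i₀) (g' i₀ - x v i₀)
    have hs' : g' i₀ - g i₀ - (g' i₀ - x v i₀) = x v i₀ - g i₀ := by ring
    rw [hs'] at hle
    have hb : |g' i₀ - x v i₀| < d / 2 := by rw [abs_sub_comm]; exact hv
    linarith [hεd i₀]
  -- the exit points: `z n = x (τ n)`, in the box, far from `g`, backward orbit in the box during `[-n, 0]`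
  have hstep : ∀ n : ℕ, ∃ τ : ℝ, (n : ℝ) ≤ τ ∧
      (∀ u ∈ Icc (-(n : ℝ)) 0, ∀ i ∈ I, |x (τ + u) i - g i| ≤ ε i) ∧
      ∃ i ∈ I, ε i / 2 ≤ |x τ i - g i| := by
    intro n
    set m : ℕ := ⌈((n : ℝ) + κ) / κ⌉₊ with hm
    have hLge : (n : ℝ) + κ ≤ m * κ := by
      have h1 : ((n : ℝ) + κ) / κ ≤ m := Nat.le_ceil _
      rw [div_le_iff₀ hκ] at h1
      exact h1
    obtain ⟨s, hs₀, hsS, hsoj⟩ :=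
      exists_long_sojourn T x hgrp hfix hg I ε hε hκ hS m (max S n)
    have hsn : (n : ℝ) ≤ s := le_trans (le_max_right _ _) hs₀
    obtain ⟨v, hv1, hv2⟩ := hexit (s + m * κ)
    obtain ⟨τ, hτ, hin, i, hi, hfar⟩ :=
      exists_exit_point x I ε g hκ hS hsS (by linarith [hLge] : κ ≤ m * κ)
        (fun t ht i hi => (hsoj t ht i hi).le.trans (by linarith [hε i])) hv1
        ⟨i₀, Finset.mem_insert_self _ _, hv2⟩
    refine ⟨τ, by linarith, fun u hu i hi => hin (τ + u) ⟨by linarith [hu.1], by linarith [hu.2]⟩ i hi,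
      i, hi, hfar⟩
  choose τ hτn hback hfar using hstep
  -- a cluster point `z` of the exit points
  have hzK : Filter.map (fun n : ℕ => x (τ n)) atTop ≤ 𝓟 K := by
    rw [Filter.le_principal_iff, Filter.mem_map]
    exact Eventually.of_forall fun n => hxK _
  obtain ⟨z, -, hz⟩ := hK.exists_mapClusterPt hzK
  -- `z ∈ Λ`
  have hzΛ : MapClusterPt z atTop x := by
    have hτ : Tendsto τ atTop atTop := tendsto_atTop_mono hτn tendsto_natCast_atTop_atTop
    exact MapClusterPt.of_comp hτ hz
  -- the box and the far set are closed
  have hbox_closed : IsClosed {h : ι → ℝ | ∀ i ∈ I, |h i - g i| ≤ ε i} := by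
    have heq : {h : ι → ℝ | ∀ i ∈ I, |h i - g i| ≤ ε i} = ⋂ i ∈ I, {h | |h i - g i| ≤ ε i} := by
      ext h
      simp only [mem_setOf_eq, mem_iInter]
    rw [heq]
    exact isClosed_biInter fun i _ =>
      isClosed_le ((continuous_apply i).sub continuous_const).abs continuous_const
  have hfar_closed : IsClosed {h : ι → ℝ | ∃ i ∈ I, ε i / 2 ≤ |h i - g i|} := by
    have heq : {h : ι → ℝ | ∃ i ∈ I, ε i / 2 ≤ |h i - g i|} = ⋃ i ∈ I, {h | ε i / 2 ≤ |h i - g i|} := by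
      ext h
      simp only [mem_setOf_eq, mem_iUnion, exists_prop]
    rw [heq]
    exact isClosed_biUnion_finset fun i _ =>
      isClosed_le continuous_const ((continuous_apply i).sub continuous_const).abs
  -- the backward orbit of `z` stays in the box
  have hzback : ∀ u : ℝ, u ≤ 0 → ∀ i ∈ I, |z (T u i) - g i| ≤ ε i := by
    intro u hu
    have hc : Continuous fun (k : ι → ℝ) (i : ι) => k (T u i) :=
      continuous_pi fun i => continuous_apply (T u i)
    have h1 : MapClusterPt (fun i => z (T u i)) atTop
        ((fun (k : ι → ℝ) (i : ι) => k (T u i)) ∘ fun n => x (τ n)) :=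
      hz.continuousAt_comp hc.continuousAt
    have h2 : ∀ᶠ n : ℕ in atTop, ((fun (k : ι → ℝ) (i : ι) => k (T u i)) ∘ fun n => x (τ n)) n ∈
        {h : ι → ℝ | ∀ i ∈ I, |h i - g i| ≤ ε i} := by
      filter_upwards [eventually_ge_atTop ⌈-u⌉₊] with n hn
      simp only [Function.comp_apply]
      intro i hi
      rw [← hgrp]
      have hn' : (⌈-u⌉₊ : ℝ) ≤ n := by exact_mod_cast hn
      exact hback n u ⟨by linarith [Nat.le_ceil (-u)], hu⟩ i hi
    exact hbox_closed.mem_of_mapClusterPt h1 h2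
  -- `z` is far from `g`, hence `z ≠ g`
  have hzfar : z ∈ {h : ι → ℝ | ∃ i ∈ I, ε i / 2 ≤ |h i - g i|} :=
    hfar_closed.mem_of_mapClusterPt hz (Eventually.of_forall fun n => hfar n)
  have hzne : z ≠ g := by
    rintro rfl
    obtain ⟨i, -, h⟩ := hzfar
    simp only [sub_self, abs_zero] at h
    linarith [hε i]
  -- `Λ ⊆ K`
  have hΛK : ∀ h : ι → ℝ, MapClusterPt h atTop x → h ∈ K := fun h hh =>
    hK.isClosed.mem_of_mapClusterPt hh (Eventually.of_forall hxK)
  -- every α-limit point `w` of `z` has its whole orbit in the box, hence is `g`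
  have huniq : ∀ w : ι → ℝ, MapClusterPt w atBot (fun (u : ℝ) (i : ι) => z (T u i)) → w = g := by
    intro w hw
    have hwΛ : MapClusterPt w atTop x :=
      isClosed_setOf_clusterPt.mem_of_mapClusterPt hw
        (Eventually.of_forall fun u => mapClusterPt_comp_of_orbit T x hgrp hzΛ u)
    refine hiso w hwΛ fun t => hboxN _ ?_
    have hc : Continuous fun (k : ι → ℝ) (i : ι) => k (T t i) :=
      continuous_pi fun i => continuous_apply (T t i)
    have h1 : MapClusterPt (fun i => w (T t i)) atBot
        ((fun (k : ι → ℝ) (i : ι) => k (T t i)) ∘ fun (u : ℝ) (i : ι) => z (T u i)) :=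
      hw.continuousAt_comp hc.continuousAt
    have h2 : ((fun (k : ι → ℝ) (i : ι) => k (T t i)) ∘ fun (u : ℝ) (i : ι) => z (T u i)) =
        (fun (u : ℝ) (i : ι) => z (T u i)) ∘ fun u => u + t := by
      funext u i
      simp only [Function.comp_apply]
      rw [hT]
    rw [h2] at h1
    have h3 : MapClusterPt (fun i => w (T t i)) atBot (fun (u : ℝ) (i : ι) => z (T u i)) :=
      MapClusterPt.of_comp (tendsto_atBot_add_const_right _ _ tendsto_id) h1
    exact hbox_closed.mem_of_mapClusterPt h3 (by
      filter_upwards [eventually_le_atBot (0 : ℝ)] with u hu using hzback u hu)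
  have htend : Tendsto (fun (u : ℝ) (i : ι) => z (T u i)) atBot (𝓝 g) :=
    hK.tendsto_nhds_of_unique_mapClusterPt
      (Eventually.of_forall fun u => hΛK _ (mapClusterPt_comp_of_orbit T x hgrp hzΛ u))
      fun w _ hw => huniq w hw
  exact hzne (hD z hzΛ htend)
/-- **Registered stub `stub_butlerWaltmanUnstable`** of the lead's skeleton (line `dilation-dynamics`):
`eq_of_isolatedInvariant_of_unstableTrivial` in closed form. [cite: ButlerWaltman1986, Lemma A1] -/
theorem stub_butlerWaltmanUnstable : ∀ (ι : Type) (T : ℝ → ι → ι) (x : ℝ → ι → ℝ), (∀ s t i, x (s + t) i = x s (T t i)) → (∀ u t i, T u (T t i) = T (u + t) i) → ∀ (K : Set (ι → ℝ)), IsCompact K → (∀ s, x s ∈ K) → (∀ i, ∀ ε > (0 : ℝ), ∃ κ > (0 : ℝ), ∃ S : ℝ, ∀ s, S ≤ s → ∀ u ∈ Set.Icc (0 : ℝ) κ, |x (s + u) i - x s i| < ε) → ∀ (g : ι → ℝ), (∀ t i, g (T t i) = g i) → MapClusterPt g Filter.atTop x → (∃ N ∈ nhds g, ∀ h : ι → ℝ,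 MapClusterPt h Filter.atTop x → (∀ t : ℝ, (fun i => h (T t i)) ∈ N) → h = g) → (∀ h : ι → ℝ, MapClusterPt h Filter.atTop x → Filter.Tendsto (fun (t : ℝ) (i : ι) => h (T t i)) Filter.atBot (nhds g) → h = g) → ∀ h : ι → ℝ, MapClusterPt h Filter.atTop x → h = g :=
  fun _ T x hgrp hT _ hK hxK hcont _ hfix hg hC hD =>
    eq_of_isolatedInvariant_of_unstableTrivial T x hgrp hT hK hxK hcont hfix hg hC hD

end ButlerWaltman

end Summit.CriticalPhenomena.CardyFormulaZ2.Theorems.CardyShadowIsolated.DilationDynamics
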